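import Summits.BirchSwinnertonDyer.Rank1Residual.X4.KimShaLengthFiveLe
import Summits.BirchSwinnertonDyer.Rank1Residual.Additive.X4KimLargeImageIntegralPeriod
import HarnessLib

/-!
# N11 (X4 ∧ r_an = 0 ∧ p = 3 ∧ surj(3)) END STATE modulo the ANNOUNCED Kim 2025 structure clause:
# on the 3-adic TOWER rows the p-part of BSD IS Kim's Conjecture 1.10 at the pair, half by half;
# the class ⟺ Conj 1.10 on admissible-datum tower rows ∧ datum-less tower rows ∧ the EXOTIC rows
# (cell `b2b-bsdres`, seat additive-p4 gen 17, line V31; CLASS-CLOSURE §3.1 N11; the `p = 3` twin of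
# `X4/KimShaLengthFiveLe{,EndState}.lean`, promised in gen 16 as the "Kim-2025 end-state update")

HONEST FRAMING (cell `b2b-bsdres`, run/shared/lean/b2b/bsd-rank1-residual/, verbatim in every
file): the goal of the cell is to DELETE the COMBINATION-SHAPED residual classes of the
Birch–Swinnerton-Dyer formula for ALL analytic-rank `≤ 1` elliptic curves over `ℚ` — "full BSD
formula for every rank `≤ 1` curve in class `C`" assembled STRICTLY from published theorems — so
that the rank-`≤ 1` remainder becomes exactly the CONSTRUCTION-SHAPED classes, which are TYPED
(missing-input `Prop`s), NOT attempted. This is not "finishing BSD". Sub-cell additive-p4 (X3♯/X4♯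
direct): research route on the CONSTRUCTION-SHAPED class X4; the label X4 and the mark of
RESIDUAL-MAP §I N11 are UNCHANGED; nothing is booked. Theorems only (no definition, no named fact
minted). **EVERY theorem below is CONDITIONAL on an UNREFEREED PREPRINT**: the binder `hK25s` =
`Kim2025.thm11_kimShaLength_of_integralPeriod_OPEN` (C.-H. Kim, app. R. Pollack, arXiv:2505.09121v1
(2025) Thm. 1.1 ("BSD") second clause, typed by team n1011 T-a4 as an OPEN hypothesis — its `p = 3`
Kolyvagin-system input, Sakamoto JTNB 36 (2024), is refereed); flag `Kim2025-preprint` on every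
theorem. An announced preprint enters ONLY as an explicitly labelled OPEN hypothesis, never as a
theorem; nothing below credits it as one.

## What this file proves

The sibling `X4/KimShaLengthFiveLe.lean` derived Kim's clause (6) at `p ≥ 5` from two PUBLISHED
one-sided facts and read off, per pair, `BSD(E,p) ⟺ Kim's Conjecture 1.10`, half by half. At
`p = 3` clause (6) is ANNOUNCED; team n1011 (p09, `Additive/X4KimLargeImageIntegralPeriod.lean`,
`kimShaLengthRankZeroAt_of_kim2025_OPEN`) bridged the preprint's own currency to cc-typer-1's typed
predicate `X4.KimShaLengthRankZeroAt W p D.f` under: `p ≥ 3`, the `p`-adic TOWER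
(`ρ̄_{E,p^n}` onto ∀ `n` = large image), `L(E,1) ≠ 0`, `Ш` finite, a modular datum `D` with the
period transfer `Ω(W) = u·Ω⁺_{D.f}` (`|u|_p = 1`) and `Ω⁺_{D.f}`-INTEGRAL plus symbols (NO Manin
clause, NO conductor-level clause). Feeding that witness to the sibling's fact-free iffs:

* §1 per pair, `p ≥ 3`, tower rows, such a datum ("admissible₃ datum"), CONDITIONAL on `hK25s`:
  `Typed.MissingLowerBoundAt W p ⟺ X4.KimTamagawaDefectLeAt W p D.f`, `MissingUpperBoundAt ⟺ …GeAt`,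
  `MissingPPartAt ⟺ BSDp W p ⟺ X4.KimTamagawaDefectAt W p D.f`.
* §2 **`n11_rankZero_three_iff_kimTamagawaDefect_of_kim2025_OPEN`** — the N11 statement ("on every
  X4 ∧ `r_an = 0` ∧ surj(3) pair, `MissingPPartAt W 3`") is EQUIVALENT, modulo the preprint, GZK and
  modularity, to: (i) Kim's Conjecture 1.10 at `3` (`∂^{(∞)}(δ̃) = ord₃ ∏_v c_v`) on every TOWER row
  for every admissible₃ datum ∧ (ii) `MissingPPartAt W 3` on the tower rows admitting NO admissible₃
  datum ∧ (iii) `MissingPPartAt W 3` on the EXOTIC rows (surj(3), no tower — Elkies' 3-adic images;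
  outside every printed or announced Kolyvagin-system route). This is gen 16's
  `n11_rankZero_three_iff_kimTamagawaDefect_of_kimShaLength` with its hypothesis (6)@3 replaced by
  the ONE announced statement that supplies it, and the EXOTIC rows made explicit.
* §3 at `p ≥ 3` on tower rows, modulo the preprint: Conjecture 1.10 holds on every CLOSED row
  (E1 calibration at `3`: the cell's RES-CERT / unit / parity-closed rows), and on rows with
  `ord_p #Ш_an ≤ 0` the `≤` half holds, i.e. a NON-ZERO cyclic Kurihara number of level
  `≤ ord_p ∏c + 1` EXISTS (the instrument-facing prediction for the Kurihara engine at `3` on the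
  TAM-DEFECT₂♭ rows, whose residue is then EXACTLY the `≥` half).

Nothing here closes N11: its residue is NAMED per pair — a printed conjecture (Kim 2026 Conj. 1.10 =
Kim 2025 Conj. 7.4/7.5) on the tower rows, plus datum-less and EXOTIC rows — CONDITIONALLY on an
announced theorem. N11 stays as marked; X4 stays CONSTRUCTION-SHAPED; nothing is booked.

References: Kim 2025 [Kim2025RefinedTNC] Thm. 1.1, Cor. 1.7, Conj. 7.4/7.5 (PRE); Kim 2026
[Kim2022StructureSelmer] Thm. 1.9 (6), Conj. 1.10; Sakamoto JTNB 36 (2024) [Sakamoto2024KolyvaginThree];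
Miller 2011 [Miller2011LMS] Def. 1.1; CLASS-CLOSURE-PLAN.md §3.1; cells/n1011/OWNERS.md T-a4/T-a2.
-/

noncomputable section

open scoped Classical MatrixGroups ModularForm

open CongruenceSubgroup WeierstrassCurve Literature.NumberTheory.EllipticCurves
  Literature.NumberTheory.EllipticCurves.ModularForms
  Literature.NumberTheory.EllipticCurves.Rank1Residual
  Literature.NumberTheory.EllipticCurves.Rank1Residual.Typed

namespace Summit.BirchSwinnertonDyer.Rank1Residual.Additive

/-! ### §1 Per pair at `p ≥ 3` on tower rows: the halves of BSD_p ⟺ the halves of Conjecture 1.10 -/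

section PerPair

variable (W : WeierstrassCurve ℚ) [W.IsElliptic] [W.IsGloballyMinimal] (p : ℕ) [Fact p.Prime]

/-- **`Typed.MissingLowerBoundAt W p ⟺ X4.KimTamagawaDefectLeAt W p D.f` at `p ≥ 3` on a tower row,
CONDITIONAL on the preprint** (`hK25s`, flag `Kim2025-preprint`): analytic rank `0` (modularity
`hmod`), GZK `hGZK`, `ρ̄_{E,p^n}` onto for all `n`, datum `D` with the period transfer and
`Ω⁺_{D.f}`-integral plus symbols. The LOWER half of BSD_p IS the `≤` half of Conjecture 1.10.
[claim: Kim2025RefinedTNC, status: under-review]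
[cite: Kim2025RefinedTNC, Thm. 1.1 ("BSD") (ANNOUNCED, OPEN binder)] [cite: Kim2022StructureSelmer, Conj. 1.10 (PDF p. 8)] -/
theorem missingLowerBoundAt_iff_kimTamagawaDefectLeAt_of_kim2025_OPEN
    (hK25s : Kim2025.thm11_kimShaLength_of_integralPeriod_OPEN)
    (hGZK : rank_eq_analyticRank_of_analyticRank_le_one) (hmod : hasEntireLFunction_rat)
    (hp3 : 3 ≤ p) (hr : W.analyticRank = 0) (htower : ∀ n : ℕ, W.HasSurjectiveModNGaloisRep (p ^ n : ℕ))
    {N : ℕ} [NeZero N] (D : ModularParametrizationData W N)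
    (hper : ∃ u : ℚ, ‖(u : ℚ_[p])‖ = 1 ∧ W.realPeriodRat = u * plusPeriod D.f)
    (hint : ∀ r : ℚ, ratPlusSymbol D.f r ≠ 0 → 0 ≤ padicValRat p (ratPlusSymbol D.f r)) :
    MissingLowerBoundAt W p ↔ X4.KimTamagawaDefectLeAt W p D.f := by
  have hL : W.entireLFunction 1 ≠ 0 := (W.analyticRank_eq_zero_iff_holds (hmod W)).mp hr
  obtain ⟨hmw, hfin⟩ := hGZK W (by rw [hr]; exact zero_le_one)
  have hsurj : W.HasSurjectiveModNGaloisRep p := by simpa using htower 1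
  obtain ⟨q, d, hq, hd, hval⟩ :=
    kimShaLengthRankZeroAt_of_kim2025_OPEN W p hK25s hp3 htower hL hfin D hper hint
  rw [X4.missingLowerBoundAt_iff_le_tamagawa_of_rankZero_witness W p hmw hfin hL
    (hasIrreducibleModPGaloisRep_of_hasSurjectiveModNGaloisRep W p hsurj) hq hval,
    X4.KimTamagawaDefectLeAt, hd, ENat.coe_le_coe]

/-- **`Typed.MissingUpperBoundAt W p ⟺ X4.KimTamagawaDefectGeAt W p D.f` at `p ≥ 3` on a tower row,
CONDITIONAL on the preprint** — the UPPER half of BSD_p IS the `≥` half of Conjecture 1.10 (the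
TAM-DEFECT₂♭ rows' missing input at `3`, named exactly). Same hypotheses.
[claim: Kim2025RefinedTNC, status: under-review]
[cite: Kim2025RefinedTNC, Thm. 1.1 ("BSD") (ANNOUNCED, OPEN binder)] [cite: Kim2022StructureSelmer, Conj. 1.10 (PDF p. 8)] -/
theorem missingUpperBoundAt_iff_kimTamagawaDefectGeAt_of_kim2025_OPEN
    (hK25s : Kim2025.thm11_kimShaLength_of_integralPeriod_OPEN)
    (hGZK : rank_eq_analyticRank_of_analyticRank_le_one) (hmod : hasEntireLFunction_rat)
    (hp3 : 3 ≤ p) (hr : W.analyticRank = 0) (htower : ∀ n : ℕ, W.HasSurjectiveModNGaloisRep (p ^ n : ℕ))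
    {N : ℕ} [NeZero N] (D : ModularParametrizationData W N)
    (hper : ∃ u : ℚ, ‖(u : ℚ_[p])‖ = 1 ∧ W.realPeriodRat = u * plusPeriod D.f)
    (hint : ∀ r : ℚ, ratPlusSymbol D.f r ≠ 0 → 0 ≤ padicValRat p (ratPlusSymbol D.f r)) :
    MissingUpperBoundAt W p ↔ X4.KimTamagawaDefectGeAt W p D.f := by
  have hL : W.entireLFunction 1 ≠ 0 := (W.analyticRank_eq_zero_iff_holds (hmod W)).mp hr
  obtain ⟨hmw, hfin⟩ := hGZK W (by rw [hr]; exact zero_le_one)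
  have hsurj : W.HasSurjectiveModNGaloisRep p := by simpa using htower 1
  obtain ⟨q, d, hq, hd, hval⟩ :=
    kimShaLengthRankZeroAt_of_kim2025_OPEN W p hK25s hp3 htower hL hfin D hper hint
  rw [X4.missingUpperBoundAt_iff_tamagawa_le_of_rankZero_witness W p hmw hfin hL
    (hasIrreducibleModPGaloisRep_of_hasSurjectiveModNGaloisRep W p hsurj) hq hval,
    X4.KimTamagawaDefectGeAt, hd, ENat.coe_le_coe]

/-- **`Typed.MissingPPartAt W p ⟺ X4.KimTamagawaDefectAt W p D.f` at `p ≥ 3` on a tower row,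
CONDITIONAL on the preprint** — gen 16's per-pair `X4RankZero.missingPPartAt_iff_kimTamagawaDefectAt_of_kimShaLength`
with (6)@p from the announced clause. [claim: Kim2025RefinedTNC, status: under-review]
[cite: Kim2025RefinedTNC, Thm. 1.1 ("BSD") (ANNOUNCED, OPEN binder)] [cite: Kim2022StructureSelmer, Conj. 1.10 (PDF p. 8)] -/
theorem missingPPartAt_iff_kimTamagawaDefectAt_of_kim2025_OPEN
    (hK25s : Kim2025.thm11_kimShaLength_of_integralPeriod_OPEN)
    (hGZK : rank_eq_analyticRank_of_analyticRank_le_one) (hmod : hasEntireLFunction_rat)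
    (hp3 : 3 ≤ p) (hr : W.analyticRank = 0) (htower : ∀ n : ℕ, W.HasSurjectiveModNGaloisRep (p ^ n : ℕ))
    {N : ℕ} [NeZero N] (D : ModularParametrizationData W N)
    (hper : ∃ u : ℚ, ‖(u : ℚ_[p])‖ = 1 ∧ W.realPeriodRat = u * plusPeriod D.f)
    (hint : ∀ r : ℚ, ratPlusSymbol D.f r ≠ 0 → 0 ≤ padicValRat p (ratPlusSymbol D.f r)) :
    MissingPPartAt W p ↔ X4.KimTamagawaDefectAt W p D.f :=
  have hL : W.entireLFunction 1 ≠ 0 := (W.analyticRank_eq_zero_iff_holds (hmod W)).mp hr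
  have hsurj : W.HasSurjectiveModNGaloisRep p := by simpa using htower 1
  X4RankZero.missingPPartAt_iff_kimTamagawaDefectAt_of_kimShaLength W p hGZK hmod hr
    (hasIrreducibleModPGaloisRep_of_hasSurjectiveModNGaloisRep W p hsurj) D.f
    (kimShaLengthRankZeroAt_of_kim2025_OPEN W p hK25s hp3 htower hL
      (hGZK W (by rw [hr]; exact zero_le_one)).2 D hper hint)

/-- **`BSD(E,p) ⟺ X4.KimTamagawaDefectAt W p D.f` at `p ≥ 3` on a tower row, CONDITIONAL on the
preprint** (Miller's currency; GZK converts). [claim: Kim2025RefinedTNC, status: under-review]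
[cite: Kim2025RefinedTNC, Thm. 1.1 ("BSD") (ANNOUNCED, OPEN binder)] [cite: Miller2011LMS, §1 and Def. 1.1] -/
theorem bsdp_iff_kimTamagawaDefectAt_of_kim2025_OPEN
    (hK25s : Kim2025.thm11_kimShaLength_of_integralPeriod_OPEN)
    (hGZK : rank_eq_analyticRank_of_analyticRank_le_one) (hmod : hasEntireLFunction_rat)
    (hp3 : 3 ≤ p) (hr : W.analyticRank = 0) (htower : ∀ n : ℕ, W.HasSurjectiveModNGaloisRep (p ^ n : ℕ))
    {N : ℕ} [NeZero N] (D : ModularParametrizationData W N)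
    (hper : ∃ u : ℚ, ‖(u : ℚ_[p])‖ = 1 ∧ W.realPeriodRat = u * plusPeriod D.f)
    (hint : ∀ r : ℚ, ratPlusSymbol D.f r ≠ 0 → 0 ≤ padicValRat p (ratPlusSymbol D.f r)) :
    BSDp W p ↔ X4.KimTamagawaDefectAt W p D.f := by
  have hr1 : W.analyticRank ≤ 1 := by rw [hr]; exact zero_le_one
  haveI : Finite W.sha := (hGZK W hr1).2
  rw [← missingPPartAt_iff_kimTamagawaDefectAt_of_kim2025_OPEN W p hK25s hGZK hmod hp3 hr htower D
    hper hint]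
  exact ⟨missingPPartAt_of_bsdp W p, bsdp_of_missingPPartAt W p hGZK hr1⟩

end PerPair

/-! ### §2 The N11 END STATE modulo the preprint -/

/-- **N11 (X4 ∧ `r_an = 0` ∧ `p = 3` ∧ surj(3)) END STATE, CONDITIONAL on the announced Kim 2025
structure clause** (`hK25s`, flag `Kim2025-preprint`), GZK and modularity: the N11 statement
"`Typed.MissingPPartAt W 3` on every X4 ∧ `r_an = 0` ∧ surj(3) pair" is EQUIVALENT to the conjunction
of (i) **Kim's Conjecture 1.10 at `3`** (`X4.KimTamagawaDefectAt W 3 D.f`, `∂^{(∞)}(δ̃) = ord₃ ∏_v c_v`)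
on every 3-adic TOWER row (`ρ̄_{E,3^n}` onto ∀ `n`) for every admissible₃ datum `D` (period transfer
`Ω(W) = u·Ω⁺_{D.f}`, `|u|₃ = 1`; `Ω⁺_{D.f}`-integral plus symbols), (ii) `MissingPPartAt W 3` on the
tower rows admitting NO admissible₃ datum, (iii) `MissingPPartAt W 3` on the EXOTIC rows (surj(3),
no tower). Per the CLASS-CLOSURE plan: the class's residue NAMED precisely — a printed conjecture on
the tower rows, plus (ii) and (iii) — conditionally on ONE announced theorem. Nothing open assumed as
a fact; N11's mark UNCHANGED; nothing booked. [claim: Kim2025RefinedTNC, status: under-review]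
[cite: Kim2025RefinedTNC, Thm. 1.1 ("BSD"), Conj. 7.4/7.5 (ANNOUNCED, OPEN binder)]
[cite: Kim2022StructureSelmer, Conj. 1.10 (PDF p. 8)] [cite: Miller2011LMS, §1 and Def. 1.1] -/
theorem n11_rankZero_three_iff_kimTamagawaDefect_of_kim2025_OPEN
    (hK25s : Kim2025.thm11_kimShaLength_of_integralPeriod_OPEN)
    (hGZK : rank_eq_analyticRank_of_analyticRank_le_one) (hmod : hasEntireLFunction_rat) :
    (∀ (W : WeierstrassCurve ℚ) [W.IsElliptic] [W.IsGloballyMinimal],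
        W.analyticRank = 0 → ClassX4 W 3 → Surj W 3 → MissingPPartAt W 3) ↔
      (∀ (W : WeierstrassCurve ℚ) [W.IsElliptic] [W.IsGloballyMinimal],
          W.analyticRank = 0 → ClassX4 W 3 → (∀ n : ℕ, W.HasSurjectiveModNGaloisRep (3 ^ n : ℕ)) →
          ∀ {N : ℕ} [NeZero N] (D : ModularParametrizationData W N),
          (∃ u : ℚ, ‖(u : ℚ_[3])‖ = 1 ∧ W.realPeriodRat = u * plusPeriod D.f) →
          (∀ r : ℚ, ratPlusSymbol D.f r ≠ 0 → 0 ≤ padicValRat 3 (ratPlusSymbol D.f r)) →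
          X4.KimTamagawaDefectAt W 3 D.f) ∧
      (∀ (W : WeierstrassCurve ℚ) [W.IsElliptic] [W.IsGloballyMinimal],
          W.analyticRank = 0 → ClassX4 W 3 → (∀ n : ℕ, W.HasSurjectiveModNGaloisRep (3 ^ n : ℕ)) →
          (∀ (N : ℕ) [NeZero N] (D : ModularParametrizationData W N),
            (¬ ∃ u : ℚ, ‖(u : ℚ_[3])‖ = 1 ∧ W.realPeriodRat = u * plusPeriod D.f) ∨
            ¬ ∀ r : ℚ, ratPlusSymbol D.f r ≠ 0 → 0 ≤ padicValRat 3 (ratPlusSymbol D.f r)) →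
          MissingPPartAt W 3) ∧
      (∀ (W : WeierstrassCurve ℚ) [W.IsElliptic] [W.IsGloballyMinimal],
          W.analyticRank = 0 → ClassX4 W 3 → Surj W 3 →
          ¬ (∀ n : ℕ, W.HasSurjectiveModNGaloisRep (3 ^ n : ℕ)) → MissingPPartAt W 3) := by
  have h3 : (3 : ℕ) ≤ 3 := le_rfl
  constructor
  · intro hN11
    refine ⟨fun W _ _ hr hX ht N _ D hper hint ↦ ?_, fun W _ _ hr hX ht _ ↦ ?_,
      fun W _ _ hr hX hs _ ↦ hN11 W hr hX hs⟩
    · have hs : W.HasSurjectiveModNGaloisRep 3 := by simpa using ht 1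
      exact (missingPPartAt_iff_kimTamagawaDefectAt_of_kim2025_OPEN W 3 hK25s hGZK hmod h3 hr ht D
        hper hint).mp (hN11 W hr hX hs)
    · have hs : W.HasSurjectiveModNGaloisRep 3 := by simpa using ht 1
      exact hN11 W hr hX hs
  · rintro ⟨hconj, hres, hexo⟩ W _ _ hr hX hs
    by_cases ht : ∀ n : ℕ, W.HasSurjectiveModNGaloisRep (3 ^ n : ℕ)
    · by_cases hD : ∃ (N : ℕ) (_ : NeZero N) (D : ModularParametrizationData W N),
          (∃ u : ℚ, ‖(u : ℚ_[3])‖ = 1 ∧ W.realPeriodRat = u * plusPeriod D.f) ∧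
            ∀ r : ℚ, ratPlusSymbol D.f r ≠ 0 → 0 ≤ padicValRat 3 (ratPlusSymbol D.f r)
      · obtain ⟨N, hNz, D, hper, hint⟩ := hD
        exact (missingPPartAt_iff_kimTamagawaDefectAt_of_kim2025_OPEN W 3 hK25s hGZK hmod h3 hr ht D
          hper hint).mpr (hconj W hr hX ht D hper hint)
      · refine hres W hr hX ht fun N _ D ↦ ?_
        by_contra hnot
        simp only [not_or, not_not] at hnot
        exact hD ⟨N, inferInstance, D, hnot.1, hnot.2⟩
    · exact hexo W hr hX hs ht

/-! ### §3 Calibration and the instrument-facing prediction at `p ≥ 3`, modulo the preprint -/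

section Calibration

variable (W : WeierstrassCurve ℚ) [W.IsElliptic] [W.IsGloballyMinimal] (p : ℕ) [Fact p.Prime]

/-- **Conjecture 1.10 holds on every CLOSED tower row at `p ≥ 3`, CONDITIONAL on the preprint**:
analytic rank `0`, tower, admissible₃ datum, and `Typed.MissingPPartAt W p` of record (certificate,
unit row, parity row, transport) ⟹ `X4.KimTamagawaDefectAt W p D.f`. The E1 calibration set at `3`.
[claim: Kim2025RefinedTNC, status: under-review]
[cite: Kim2025RefinedTNC, Thm. 1.1 ("BSD") (ANNOUNCED, OPEN binder)] [cite: Kim2022StructureSelmer, Conj. 1.10 (PDF p. 8)] -/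
theorem kimTamagawaDefectAt_of_missingPPartAt_of_kim2025_OPEN
    (hK25s : Kim2025.thm11_kimShaLength_of_integralPeriod_OPEN)
    (hGZK : rank_eq_analyticRank_of_analyticRank_le_one) (hmod : hasEntireLFunction_rat)
    (hp3 : 3 ≤ p) (hr : W.analyticRank = 0) (htower : ∀ n : ℕ, W.HasSurjectiveModNGaloisRep (p ^ n : ℕ))
    {N : ℕ} [NeZero N] (D : ModularParametrizationData W N)
    (hper : ∃ u : ℚ, ‖(u : ℚ_[p])‖ = 1 ∧ W.realPeriodRat = u * plusPeriod D.f)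
    (hint : ∀ r : ℚ, ratPlusSymbol D.f r ≠ 0 → 0 ≤ padicValRat p (ratPlusSymbol D.f r))
    (h : MissingPPartAt W p) : X4.KimTamagawaDefectAt W p D.f :=
  (missingPPartAt_iff_kimTamagawaDefectAt_of_kim2025_OPEN W p hK25s hGZK hmod hp3 hr htower D hper
    hint).mp h

/-- **On tower rows with `ord_p #Ш_an ≤ 0` the `≤` half of Conjecture 1.10 holds at `p ≥ 3`,
CONDITIONAL on the preprint** (the LOWER half is trivial there). On the TAM-DEFECT₂♭ rows
(`3 ∣ ∏c`, `3 ∤ #Ш_an`, tower) the missing input at `3` is therefore EXACTLY the `≥` half.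
[claim: Kim2025RefinedTNC, status: under-review]
[cite: Kim2025RefinedTNC, Thm. 1.1 ("BSD") (ANNOUNCED, OPEN binder)] [cite: Kim2022StructureSelmer, Conj. 1.10 (PDF p. 8)] -/
theorem kimTamagawaDefectLeAt_of_shaAn_val_nonpos_of_kim2025_OPEN
    (hK25s : Kim2025.thm11_kimShaLength_of_integralPeriod_OPEN)
    (hGZK : rank_eq_analyticRank_of_analyticRank_le_one) (hmod : hasEntireLFunction_rat)
    (hp3 : 3 ≤ p) (hr : W.analyticRank = 0) (htower : ∀ n : ℕ, W.HasSurjectiveModNGaloisRep (p ^ n : ℕ))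
    {N : ℕ} [NeZero N] (D : ModularParametrizationData W N)
    (hper : ∃ u : ℚ, ‖(u : ℚ_[p])‖ = 1 ∧ W.realPeriodRat = u * plusPeriod D.f)
    (hint : ∀ r : ℚ, ratPlusSymbol D.f r ≠ 0 → 0 ≤ padicValRat p (ratPlusSymbol D.f r))
    (hsha : ∃ q' : ℚ, shaAn W = (q' : ℂ) ∧ padicValRat p q' ≤ 0) :
    X4.KimTamagawaDefectLeAt W p D.f := by
  obtain ⟨q', hq', hv⟩ := hsha
  exact (missingLowerBoundAt_iff_kimTamagawaDefectLeAt_of_kim2025_OPEN W p hK25s hGZK hmod hp3 hr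
    htower D hper hint).mp ⟨q', hq', hv.trans (by positivity)⟩

/-- **… hence such a row carries a NON-ZERO Kurihara number at a cyclic level `n ∈ 𝒩_k`,
`1 ≤ k ≤ ord_p ∏_v c_v + 1`, CONDITIONAL on the preprint** — the kernel form of the prediction for
the Kurihara-number engine at `3` on the X4 ∧ `r_an = 0` ∧ tower ∧ `3 ∤ #Ш_an` rows (TAM-DEFECT₂♭
included): an existence statement, confirmable per pair by exhibiting the level. EVIDENCE use only.
[claim: Kim2025RefinedTNC, status: under-review]
[cite: Kim2025RefinedTNC, Thm. 1.1 ("BSD") (ANNOUNCED, OPEN binder)] [cite: Kim2022StructureSelmer, Conj. 1.10 and §1.5.1 (PDF pp. 7–8)] -/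
theorem exists_kuriharaNumber_ne_zero_of_shaAn_val_nonpos_of_kim2025_OPEN
    (hK25s : Kim2025.thm11_kimShaLength_of_integralPeriod_OPEN)
    (hGZK : rank_eq_analyticRank_of_analyticRank_le_one) (hmod : hasEntireLFunction_rat)
    (hp3 : 3 ≤ p) (hr : W.analyticRank = 0) (htower : ∀ n : ℕ, W.HasSurjectiveModNGaloisRep (p ^ n : ℕ))
    {N : ℕ} [NeZero N] (D : ModularParametrizationData W N)
    (hper : ∃ u : ℚ, ‖(u : ℚ_[p])‖ = 1 ∧ W.realPeriodRat = u * plusPeriod D.f)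
    (hint : ∀ r : ℚ, ratPlusSymbol D.f r ≠ 0 → 0 ≤ padicValRat p (ratPlusSymbol D.f r))
    (hsha : ∃ q' : ℚ, shaAn W = (q' : ℂ) ∧ padicValRat p q' ≤ 0) :
    ∃ (n k : ℕ) (hk : Kato.IsKolyvaginProduct W p k n), IsCyclicKolyvaginLevel W p n ∧
      1 ≤ k ∧ k ≤ padicValNat p W.tamagawaProduct + 1 ∧
      ∃ ψ : (ℓ : ℕ) → (ZMod ℓ)ˣ →* Multiplicative (ZMod (p ^ k)),
        (∀ ℓ ∈ n.primeFactors, Function.Surjective (ψ ℓ)) ∧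
        (haveI : NeZero n := ⟨hk.ne_zero⟩; kuriharaNumber D.f (p ^ k) n ψ ≠ 0) :=
  X4.exists_certificate_of_kuriharaPartialInfty_le W p D.f
    (kimTamagawaDefectLeAt_of_shaAn_val_nonpos_of_kim2025_OPEN W p hK25s hGZK hmod hp3 hr htower D hper
      hint hsha)

end Calibration

end Summit.BirchSwinnertonDyer.Rank1Residual.Additive

end
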